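/-
Fleet lead `ym-wcr-19609-p1` (seat prover-ym-wcr-19609-p1-g2-0), route `WeakCouplingRates`, crux `BulkDominatesColdBoxW`
(stmt-QuantumFields-19609), line `dlr-chessboard` (v4), brick M1 of the census v3 (item evidence #12).
-/
import Summits.QuantumFields.YangMills.Theorems.WeakCouplingRatesColdBoxForestGaugeIntegral

/-!
# Crux `BulkDominatesColdBoxW`, stubs L1a/L1b: the DLR box kernel with an ARBITRARY boundary datum in the temporal-forest gauge

Brick M1 of the census v3 of the line `dlr-chessboard` (item evidence #12): the twin, for a general exterior datum `ω`, of the flat-wall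
theorem `integral_boxState_eq_coldFree` (`Theorems/WeakCouplingRatesColdBoxForestGaugeIntegral.lean`, crux `ColdBoxTwoPointFloorW`).
The temporal-forest gauge transformation `forestGauge H U` is the identity at every vertex that is not an interior vertex of the cold box
`{0,…,2H}⁴`, and it only reads the interior temporal links; hence it does not move the links off the box (the datum) and it does not
depend on them:

* `forestGauge_glueWith` — the forest gauge of `glueWith Λ u ω` is that of the cold-wall extension `coldExt u`, for every datum `ω`;
* `glueWith_coldFixBox` — gluing the gauge-fixed box configuration to `ω` = gauge-fixing the glued configuration;
* `integral_ymSpecification_box_eq_coldFree` — **for every datum `ω` and every measurable gauge-invariant `F`,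
  `∫ F dγ_Λ(·|ω) = ∫ F(U_v^ω) e^{−β S_Λ(U_v^ω)} dσ^{free}(v) / ∫ e^{−β S_Λ(U_v^ω)} dσ^{free}(v)`**, `U_v^ω` = free links `v`, forest
  links `1`, exterior links `ω` (`glueWith Λ (coldExt₁ v) ω`), `σ^{free}` = product Haar on the free edges — the integration variables of
  the one-scale expansion with a boundary datum (`ω ≡ 1` is the flat theorem).

No new definition; standard axioms.  NOT a claim about the mass gap.
-/

set_option autoImplicit false

noncomputable section

open MeasureTheory Finset Function
open Literature.Probability.LatticeModels (Site glueWith glueWith_apply_mem glueWith_apply_not_mem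
  measurable_glueWith)
open Literature.MathematicalPhysics.QuantumLattice
open Literature.MathematicalPhysics.QuantumFieldTheory
open Literature.MathematicalPhysics.QuantumFieldTheory.AxialGauge

namespace Summit.QuantumFields.YangMills.Theorems.WeakCouplingRates

variable {G : Type*} [Group G] {H : ℕ}

/-- **The forest gauge does not read the datum**: for every box configuration `u` and every exterior datum `ω`, the temporal-forest
gauge transformation of `glueWith Λ u ω` is that of the cold-wall extension `coldExt u` (it only reads interior temporal links, which
are box links). -/
theorem forestGauge_glueWith (u : ColdCfg (G := G) H) (ω : LGConfig 4 G) (x : Site 4) :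
    forestGauge H (glueWith (boxEdges 4 (2 * H + 1)) u ω) x = forestGauge H (coldExt u) x := by
  refine forestGauge_congr (fun y hy => ?_) x
  have hmem : (y, (0 : Fin 4)) ∈ boxEdges 4 (2 * H + 1) := by
    rw [mem_boxEdges_iff]
    exact ⟨fun k => by have := hy k; constructor <;> push_cast <;> omega, by have := hy 0; push_cast; omega⟩
  rw [glueWith_apply_mem _ _ _ hmem, coldExt_apply_mem u ⟨(y, 0), hmem⟩]

/-- **Gluing the gauge-fixed box configuration to the datum = gauge-fixing the glued configuration** (twin of `coldExt_coldFixBox`):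
off the box both endpoints of an edge are non-interior, where the forest gauge is `1`, so the datum is untouched. -/
theorem glueWith_coldFixBox (u : ColdCfg (G := G) H) (ω : LGConfig 4 G) :
    glueWith (boxEdges 4 (2 * H + 1)) (coldFixBox u) ω = forestFix H (glueWith (boxEdges 4 (2 * H + 1)) u ω) := by
  funext e
  by_cases he : e ∈ boxEdges 4 (2 * H + 1)
  · rw [glueWith_apply_mem _ _ _ he, forestFix_apply, forestGauge_glueWith, forestGauge_glueWith, glueWith_apply_mem _ _ _ he]
    change forestFix H (coldExt u) e = _
    rw [forestFix_apply, coldExt_apply_mem u ⟨e, he⟩]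
  · rw [glueWith_apply_not_mem _ _ _ he, forestFix_apply, glueWith_apply_not_mem _ _ _ he]
    obtain ⟨x, i⟩ := e
    obtain ⟨h1, h2⟩ := not_interior_of_not_mem_boxEdges (H := H) he
    rw [forestGauge_of_not_interior _ h1, forestGauge_of_not_interior _ h2]
    group

variable {N : ℕ} [TopologicalSpace G] [IsTopologicalGroup G] [CompactSpace G] [MeasurableSpace G] [BorelSpace G]
  [SecondCountableTopology G] (ρ : G →* Matrix (Fin N) (Fin N) ℂ)

/-- **The DLR box kernel with boundary datum `ω` in the temporal-forest gauge** (twin of `integral_boxState_eq_coldFree`, which is the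
case `ω ≡ 1`).  For a measurable gauge-invariant observable `F` and EVERY datum `ω`,
`∫ F dγ_Λ(·|ω) = ∫ F(U_v^ω) e^{−β S_Λ(U_v^ω)} dσ^{free}(v) / ∫ e^{−β S_Λ(U_v^ω)} dσ^{free}(v)`, `Λ = boxEdges 4 (2H+1)`, where
`U_v^ω = glueWith Λ (coldExt₁ v) ω` carries the free links `v`, the forest links `1` and the exterior links `ω`, and `σ^{free}` is the
product Haar measure on the free (non-forest) edges of the cold box. -/
theorem integral_ymSpecification_box_eq_coldFree (hρ : Continuous ρ) (β : ℝ) (H : ℕ) (ω : LGConfig 4 G)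
    {F : LGConfig 4 G → ℝ} (hF : Measurable F) (hFinv : IsZdGaugeInvariant F) :
    ∫ U, F U ∂(ymSpecification ρ β (boxEdges 4 (2 * H + 1)) ω) =
      (∫ v, F (glueWith (boxEdges 4 (2 * H + 1)) (coldExt₁ v) ω) *
          Real.exp (-β * wilsonBoundaryAction ρ (boxEdges 4 (2 * H + 1)) (glueWith (boxEdges 4 (2 * H + 1)) (coldExt₁ v) ω))
        ∂(Measure.pi fun _ : {e : ↥(boxEdges 4 (2 * H + 1)) //
          ¬ (e.1.2 = 0 ∧ ∀ k : Fin 4, 1 ≤ e.1.1 k ∧ e.1.1 k + 1 ≤ 2 * (H : ℤ))} => haarProbability G)) /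
      ∫ v, Real.exp (-β * wilsonBoundaryAction ρ (boxEdges 4 (2 * H + 1)) (glueWith (boxEdges 4 (2 * H + 1)) (coldExt₁ v) ω))
        ∂(Measure.pi fun _ : {e : ↥(boxEdges 4 (2 * H + 1)) //
          ¬ (e.1.2 = 0 ∧ ∀ k : Fin 4, 1 ≤ e.1.1 k ∧ e.1.1 k + 1 ≤ 2 * (H : ℤ))} => haarProbability G) := by
  rw [integral_ymSpecification ρ hρ β _ hF]
  have hSc : Continuous fun U : LGConfig 4 G => Real.exp (-β * wilsonBoundaryAction ρ (boxEdges 4 (2 * H + 1)) U) :=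
    Real.continuous_exp.comp (continuous_const.mul (continuous_wilsonBoundaryAction ρ hρ _))
  have hg : Measurable fun ζ : ColdCfg (G := G) H => glueWith (boxEdges 4 (2 * H + 1)) ζ ω := measurable_glueWith _ _
  -- invariance of both integrands under the forest gauge fixing of the box links
  have hinvS : ∀ u : ColdCfg (G := G) H,
      wilsonBoundaryAction ρ (boxEdges 4 (2 * H + 1)) (glueWith (boxEdges 4 (2 * H + 1)) (coldFixBox u) ω) =
        wilsonBoundaryAction ρ (boxEdges 4 (2 * H + 1)) (glueWith (boxEdges 4 (2 * H + 1)) u ω) := fun u => by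
    rw [glueWith_coldFixBox, forestFix, wilsonBoundaryAction_gaugeTransformZd]
  have hinvF : ∀ u : ColdCfg (G := G) H,
      F (glueWith (boxEdges 4 (2 * H + 1)) (coldFixBox u) ω) = F (glueWith (boxEdges 4 (2 * H + 1)) u ω) := fun u => by
    rw [glueWith_coldFixBox, forestFix, hFinv]
  have h1 := integral_pi_eq_integral_coldFree (H := H)
    (Ψ := fun ζ => F (glueWith (boxEdges 4 (2 * H + 1)) ζ ω) *
      Real.exp (-β * wilsonBoundaryAction ρ (boxEdges 4 (2 * H + 1)) (glueWith (boxEdges 4 (2 * H + 1)) ζ ω)))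
    ((hF.comp hg).mul (hSc.measurable.comp hg)) (fun u => by simp only [hinvF u, hinvS u])
  have h2 := integral_pi_eq_integral_coldFree (H := H)
    (Ψ := fun ζ => Real.exp (-β * wilsonBoundaryAction ρ (boxEdges 4 (2 * H + 1)) (glueWith (boxEdges 4 (2 * H + 1)) ζ ω)))
    (hSc.measurable.comp hg) (fun u => by simp only [hinvS u])
  rw [h1, h2]

end Summit.QuantumFields.YangMills.Theorems.WeakCouplingRates

end
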